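import Literature.Claims.NS.ClayVariants
import Literature.Analysis.FluidPDE.ClaySettingParasiticDrift
import Literature.Analysis.FluidPDE.WholeSpaceIBP
import Literature.Analysis.FluidPDE.AxisymHouLiVariables
import Literature.Analysis.FunctionSpaces.GaussianSchwartz
import HarnessLib

/-!
# Claim skeleton (D-0090 NS-CLAIMS, C131; T3 QUICK): Santos Godoi 2016 — «Three Examples of
# Unbounded Energy for t > 0»

Typed skeleton of Valdir Monteiro dos Santos Godoi, *Three Examples of Unbounded Energy for t > 0*,
Journal of Physical Mathematics 7(3) (2016) art. 1000196, doi:10.4172/2090-0902.1000196 (10 pp.; PDF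
page = printed page, two columns) = bib `Godoi2016`, text of record of cell `ns-claims` row C131 (sources
`run/shared/lean/pub/ns-claims/sources/Godoi2016/`: PDF, text layer `text/p001–p010.txt`, renders
`renders/p001–p010.png` read by the typist). UNREFEREED CLAIM under adjudication — NOTHING in this file
asserts a disputed step of the paper: the paper's inferences are `def … : Prop`; the `theorem`s are the
kernel composition of the paper's own chain (`claim_of_steps`, `claim_of_uniq`), the Clay identification
(`claimedTheorem_iff_clayC`), the inference of Step 3 (valid GIVEN Step 2, `not_solvable_of_badSolution`)
and kernel facts about the paper's explicit Example 1 in its simplest printed instance `u⁰ ≡ 0` (p.2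
col.2 «Simpler it would be to choose u⁰(x) = 0»), which is the tree's parasitic drift
(`Literature.Analysis.FluidPDE.ClaySettingParasiticDrift`). Verdict vocabulary is the refuter's /
referee's. QUICK statement grain (cell RULINGS v1.30h (b)).

## The claimed statement, as printed (Abstract p.1; (C) quoted p.1 col.1 bottom – p.2 col.1 top; the
## «overview of the problem's conditions» box p.8 col.1; Conclusion p.8 col.1)
Abstract: «We have proved that there are initial velocities and forces such that there is no physically
reasonable solution to the Navier-Stokes equations for [t > 0], which corresponds to the case (C) of the
problem». p.1–2: «C) Breakdown solutions of Navier-Stokes on ℝ³. Take ν > 0 and n = 3. Then there exist a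
smooth and divergence-free vector field u⁰(x) on ℝ³ and a smooth external force f(x,t) on ℝ³ × [0,∞),
satisfying (4) [and (5)], for which there exist no solutions (p,u) of (1), (2), (3), (6), (7) on
ℝ³ × [0,∞)». Box p.8 col.1: «ν > 0, n = 3 · ∃u⁰(x): ℝ³ smooth (C^∞), divergence-free · ∃f(x,t): ℝ³×[0,∞)
smooth · (4) · (5) · ∄(p,u): ℝ³×[0,∞) / (1) (2) (3) (6) (7) (bounded energy)». This is Clay (C) token
for token: `ClaimedTheorem` below is `∀ ν > 0, clayR3.BreakdownAt ν` and `claimedTheorem_iff_clayC :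
ClaimedTheorem ↔ NavierStokesBreakdownR3` is the tree's `clayR3_breakdown_iff`. Delta to Clay at the
STATEMENT: **none on every axis** (Δ1 ℝ³ · Δ2 (1)–(3) · Δ3 force of class (5) · Δ4 datum of class (4) ·
Δ5 (6) ∧ (7) in the excluded solution class · Δ6 ∃ data, ∄ solution · Δ7 ν > 0). The delta lives INSIDE
the chain: the paper's working notion of «breakdown solution» is a solution of (1)(2)(3)(6) that VIOLATES
(7) (p.1 col.1 «to get the breakdown solutions, (1), (2), (3), (6) or (7) could not be satisfied … we can
try get a breakdown solutions in t ≥ 0 violating the condition (7)», display (10) `∫|u(x,t)|²dx → ∞`),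
bridged to (C)'s NON-EXISTENCE by a uniqueness sentence (Step 2).

## The printed chain and the ordered Step index (`claim_of_steps` consumes Steps 1, 2; Step 3 is PROVED
## given Step 2)
* Step 1 = `Example1` — «Examples», p.2 col.2 (13.1)–(16): datum (13.1) `u⁰(x) = e^{−|x|²}(x₂x₃, x₁x₃,
  −2x₁x₂)`, secondary velocity (13.2) `vᵢ(t) = w(t) = e^{−t}(1 − e^{−t})`, velocity (13.3) `uᵢ(x,t) =
  u⁰ᵢ(x)e^{−t} + vᵢ(t)`, force (13.4) `fᵢ = (−u⁰ᵢ + e^{−t}Σⱼu⁰ⱼ∂ⱼu⁰ᵢ + Σⱼvⱼ∂ⱼu⁰ᵢ − ν∇²u⁰ᵢ)e^{−t}`,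
  (14) `∇p + ∂v/∂t = 0`, pressure (15) `p(x,t) = −(dw/dt)(x₁+x₂+x₃) + θ(t)`, conclusion (16)ff «and so
  ∫|u(x,t)|²dx → ∞ for t > 0, as we wanted. Simpler it would be to choose u⁰(x) = 0»: a smooth solution of
  (1)(2)(3)(6) from a datum of class (4) with a force of class (5) whose energy is infinite at every
  `t > 0`. A CORRECT construction (the spatially constant `v(t)` is the parasitic drift of
  Koch–Nadirashvili–Seregin–Šverák 2009 §1); its `u⁰ ≡ 0` instance (then `f ≡ 0` by (13.4)) is PROVED
  here (`example1_zero`). Examples 2 (p.2 col.2 – p.4, (17.1)–(43): `v = e^{−t}w(x₁−x₂,t)(1,1,0)`, plane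
  waves `X(ξ) = A cos(Bξ) + C sen(±Bξ)`, energy infinite by (21) «∫_{ℝ³}|v|²dx = C₂∫dx₃ → ∞») and 3 (p.7–8,
  (80)–(91), `ξ = x₁ + x₂/α − 2x₃/β`) follow the same schema (92) `u(x,t) = [u⁰(x) + w(x)(1 − e^{−t})]e^{−t}`
  and feed the SAME Steps 2–3; they are not typed separately at the QUICK grain.
* Step 2 = `UniqLocal` (sentence grain; instance grain `UniqAt`; global grain `UniqGlobal`) — p.8 col.2
  ¶1–¶3: «claim that there is no solution (p,u) to the system (1), (2), (3), (6) and (7) might assume that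
  we explored … the infinite possible combinations of p and u … So we need that exists uniqueness of
  solution for the velocity that we build, eliminating other possible velocitys for the same data used,
  u⁰(x) and f(x,t), and involving in finite total kinetic energy. ¶ The uniqueness of the solution (except
  due the pressure …) comes from classical results already known, for example described in the mentioned
  article of Fefferman [1]: the system of Navier-Stokes equations (1), (2), (3) it has unique solution
  for all t ≥ 0 or only for a finite time interval [0,T) depending on the initial data, where T is called
  "blowup time". … therefore the solutions found in the previous cases are unique at all times (unless
  pressure). But even if there were a finite T …, the uniqueness would exist in at least a small interval
  of time». LOAD-BEARING. Typed AS PRINTED: uniqueness of the velocity among smooth solutions of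
  (1)(2)(3)(6) on `ℝ³ × [0,∞)` with the same `(u⁰, f)` — NO energy class (7) on the competitors (the
  sentence names (1)(2)(3) only, and the paper applies it to its own infinite-energy `u`, which (7)
  would exclude).
* Step 3 = the inference p.8 col.2 ¶3 end «which is enough to show that in this time range occurs the
  breakdown of Navier-Stokes solutions because it was disobeyed the limited kinetic energy condition (7),
  making the case (C) true»: a smooth solution with infinite energy at every `t > 0` + Step 2 at its data
  ⇒ no solution of (1)(2)(3)(6)(7) for that data. VALID given Step 2 — PROVED (`not_solvable_of_badSolution`).
COMPOSITION: `claim_of_steps : Example1 → UniqLocal → ClaimedTheorem` and, through the proved `u⁰ ≡ 0`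
instance, `claim_of_uniq : UniqLocal → ClaimedTheorem`, `claim_of_uniqAt_zero : (∀ ν > 0, UniqAt ν 0 0) →
ClaimedTheorem` (all PROVED, pure logic over the tree).
NOT ON THE PATH (recorded, not typed): the alternative «breakdown» route (8)–(9) p.1 col.1–2 (a
non-gradient `φ = ∂ₜu + (u·∇)u − νΔu − f` leaves (1) without a pressure) — announced, not used by the
examples; §6–§7 pp.4–7 (non-uniqueness musings for n = 2, «15th Problem of Smale») — commentary.

## References
* V. M. dos Santos Godoi, J. Phys. Math. 7(3) (2016) 1000196 (`Godoi2016`): Abstract p.1; Introduction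
  p.1–2 ((1)–(10), (C) quoted); «Examples» p.2 col.2 – p.4 ((13.1)–(16) Example 1; (17.1)–(43) Example 2);
  §8 pp.7–8 ((80)–(91) Example 3); Conclusion p.8 (box of conditions, (92), uniqueness ¶ col.2).
* G. Koch, N. Nadirashvili, G. Seregin, V. Šverák, Acta Math. 203 (2009), §1 (parasitic solutions
  `u = b(t)`, `p = −b′(t)·x`) [KochNadirashviliSereginSverak2009] — tree file
  `Literature/Analysis/FluidPDE/ClaySettingParasiticDrift.lean`.
* Cell files: `claims/Godoi2016/CARD.md` (typist-12 g2; PREDICTION 2026-08-27T03:26:26Z),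
  `claims/Godoi2016/SALVAGE.md` (salvage-p5 g2), `sources/Godoi2016/LOCATORS.md` (typist-12 g2).

WHAT THIS IS NOT: not a claim about NS regularity or blow-up; not a claim about any author beyond the
typed locator.
-/

noncomputable section

open Set MeasureTheory
open scoped ContDiff ENNReal RealInnerProductSpace
open Laplacian

namespace Literature.Claims.NS.Godoi2016

open Literature.Analysis.FluidPDE Literature.Claims.NS.ClayVariants

/-- Physical space `ℝ³`. [folklore] -/
abbrev R3 : Type := EuclideanSpace ℝ (Fin 3)

/-! ## The explicit objects of Example 1 (p.2 col.2, (13.1)–(15)) -/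

/-- (13.2): the time profile `w(t) = e^{−t}(1 − e^{−t})` of the secondary velocity (`w(0) = 0`,
`w(t) > 0` for `t > 0`). [cite: Godoi2016, (13.2) p.2 col.2] -/
def w (t : ℝ) : ℝ := Real.exp (-t) * (1 - Real.exp (-t))

/-- The diagonal vector `(1,1,1)`: (13.2) sets `vᵢ(t) = w(t)` for `1 ≤ i ≤ 3`, i.e. `v(t) = w(t)(1,1,1)`.
[cite: Godoi2016, (13.2) p.2 col.2] -/
def diag : R3 := !₂[1, 1, 1]

/-- (13.2): the secondary velocity `v(t) = w(t)(1,1,1)` — spatially constant, `v(0) = 0`, `v(t) ≠ 0` for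
`t > 0` (the parasitic drift profile). [cite: Godoi2016, (13.2) p.2 col.2] -/
def drift (t : ℝ) : R3 := w t • diag

/-- (13.1): the datum `u⁰(x) = e^{−(x₁²+x₂²+x₃²)}(x₂x₃, x₁x₃, −2x₁x₂)` (coordinates `x 0, x 1, x 2`).
[cite: Godoi2016, (13.1) p.2 col.2] -/
def datum1 (x : R3) : R3 :=
  Real.exp (-(‖x‖ ^ 2)) • !₂[x 1 * x 2, x 0 * x 2, -2 * x 0 * x 1]

/-- (13.3): the velocity `uᵢ(x,t) = u⁰ᵢ(x)e^{−t} + vᵢ(t)` built on a datum `u₀` (the paper's `u⁰` of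
(13.1), or `u⁰ ≡ 0`: «Simpler it would be to choose u⁰(x) = 0», p.2 col.2).
[cite: Godoi2016, (13.3) p.2 col.2] -/
def velocity1 (u₀ : R3 → R3) (t : ℝ) (x : R3) : R3 := Real.exp (-t) • u₀ x + drift t

/-- (15): the pressure `p(x,t) = −(dw/dt)(x₁ + x₂ + x₃) + θ(t)` solving (14) `∇p + ∂v/∂t = 0`, with the
paper's «general time dependence θ(t)». [cite: Godoi2016, (14)–(15) p.2 col.2] -/
def pressure1 (θ : ℝ → ℝ) (t : ℝ) (x : R3) : ℝ := -deriv w t * (x 0 + x 1 + x 2) + θ t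

/-- (13.4): the fitted force `fᵢ = (−u⁰ᵢ + e^{−t}Σⱼu⁰ⱼ∂ⱼu⁰ᵢ + Σⱼvⱼ∂ⱼu⁰ᵢ − ν∇²u⁰ᵢ)e^{−t}`, i.e.
`f = e^{−t}(−u₀ + e^{−t}(u₀·∇)u₀ + (v·∇)u₀ − νΔu₀)` with `(a·∇)u₀ = Du₀(x)[a]`.
[cite: Godoi2016, (13.4) p.2 col.2] -/
def force1 (ν : ℝ) (u₀ : R3 → R3) (t : ℝ) (x : R3) : R3 :=
  Real.exp (-t) • (-u₀ x + Real.exp (-t) • fderiv ℝ u₀ x (u₀ x) + fderiv ℝ u₀ x (drift t) - ν • Δ u₀ x)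

/-! ## The claimed statement -/

/-- **CLAIMED THEOREM (Abstract p.1; (C) quoted p.1 col.1 – p.2 col.1; box p.8 col.1; = Clay (C) as
printed)**: for every `ν > 0` there are a smooth divergence-free datum `u⁰` of class (4) and a smooth
force `f` of class (5) for which NO `(p,u)` smooth on `ℝ³ × [0,∞)` solves (1), (2), (3) with bounded
energy (7). [claim: Godoi2016, status: under-review] [cite: Godoi2016, Abstract p.1; (C) p.1–2; box p.8 col.1] -/
def ClaimedTheorem : Prop :=
  ∀ ν : ℝ, 0 < ν → clayR3.BreakdownAt ν

/-- **Delta to Clay = none at the statement**: the printed statement is Clay (C) — `clayR3.Breakdown`,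
i.e. the conjecture leaf `NavierStokesBreakdownR3` (`ClayVariants.clayR3_breakdown_iff`).
[cite: Godoi2016, (C) p.1–2; box p.8 col.1] -/
theorem claimedTheorem_iff_clayC :
    ClaimedTheorem ↔ Summit.NavierStokesRegularity.NavierStokesRegularity.NavierStokesBreakdownR3 :=
  clayR3_breakdown_iff

/-- Schema form of the identification (cell TYPING-HYGIENE 10(b)). [cite: Godoi2016, (C) p.1–2] -/
theorem clay_of_claimed (h : ClaimedTheorem) : clayR3.Breakdown := h

/-- **The paper's conclusion AT ITS WITNESSES** (Conclusion p.8 col.1 «finding, this way, a possible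
solution to (1), (2), (3), (4), (5) and (6), and only (7) wouldn't be satisfied for t > 0 … We then show
examples of breakdown solutions to case (C)»; box «∄(p,u) … (1) (2) (3) (6) (7)»): the data `(u⁰, f)` of an
example admit no Clay-sense solution. [claim: Godoi2016, status: under-review] [cite: Godoi2016, Conclusion p.8 col.1] -/
def NoAdmissibleSolution (ν : ℝ) (u₀ : R3 → R3) (f : ℝ → R3 → R3) : Prop :=
  ¬ clayR3.Solvable ν f u₀

/-! ## The Steps (the disputed ones are `def`s; Example 1 with `u⁰ ≡ 0` and Step 3 are proved) -/

/-- **Step 1 — Example 1 as printed** ((13.1)–(16) p.2 col.2, with «choosing u⁰(x) ∈ S(ℝ³) and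
f(x,t) ∈ S(ℝ³ × [0,∞)), obeying this way (4) and (5)» and Conclusion p.8 col.1 «All three examples obey
the necessary conditions …»): for every `ν > 0` and every smooth `θ`, the datum (13.1) is smooth,
divergence free, of class (4); the force (13.4) is smooth of class (5); `(u, p)` of (13.3)/(15) is
smooth on `ℝ³ × [0,∞)` and solves (1), (2), (3); and `∫|u(x,t)|²dx = ∞` for every `t > 0`. A correct
construction; typed, not attacked, not proved at this grain (its `u⁰ ≡ 0` instance is `example1_zero`).
[claim: Godoi2016, status: under-review] [cite: Godoi2016, (13.1)–(16) p.2 col.2; Conclusion p.8 col.1] -/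
def Example1 : Prop :=
  ∀ ν : ℝ, 0 < ν → ∀ θ : ℝ → ℝ, ContDiff ℝ ∞ θ →
    ContDiff ℝ ∞ datum1 ∧ NSWave0.IsDivFree datum1 ∧ HasRapidSpatialDecay datum1 ∧
    IsSmoothOnHalfSpace (force1 ν datum1) ∧ HasRapidSpaceTimeDecay (force1 ν datum1) ∧
    IsSmoothOnHalfSpace (velocity1 datum1) ∧ IsSmoothOnHalfSpace (pressure1 θ) ∧
    IsNavierStokesSolution ν (force1 ν datum1) datum1 (velocity1 datum1) (pressure1 θ) ∧
      ∀ t : ℝ, 0 < t → ∫⁻ x, ‖velocity1 datum1 t x‖ₑ ^ 2 = ⊤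

/-- **Step 2, instance grain — velocity uniqueness for the data `(u₀, f)`** (p.8 col.2 ¶2–¶3 «the system
of Navier-Stokes equations (1), (2), (3) it has unique solution for all t ≥ 0 or only for a finite time
interval [0,T) … the uniqueness would exist in at least a small interval of time», «unless pressure»):
any two solutions of (1), (2), (3), smooth on `ℝ³ × [0,∞)` ((6)), with the same viscosity, force and
datum have the same velocity on some `[0,T)`, `T > 0`. AS PRINTED: no energy condition (7) on either
solution. [claim: Godoi2016, status: under-review] [cite: Godoi2016, p.8 col.2 ¶2–¶3] -/
def UniqAt (ν : ℝ) (u₀ : R3 → R3) (f : ℝ → R3 → R3) : Prop :=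
  ∀ (u v : ℝ → R3 → R3) (p q : ℝ → R3 → ℝ),
    IsSmoothOnHalfSpace u → IsSmoothOnHalfSpace p → IsNavierStokesSolution ν f u₀ u p →
    IsSmoothOnHalfSpace v → IsSmoothOnHalfSpace q → IsNavierStokesSolution ν f u₀ v q →
      ∃ T : ℝ, 0 < T ∧ ∀ t ∈ Ico 0 T, u t = v t

/-- **Step 2 — LOCAL uniqueness, sentence grain** (p.8 col.2 ¶2 «comes from classical results already
known, for example described in the mentioned article of Fefferman [1]: the system of Navier-Stokes
equations (1), (2), (3) it has unique solution for all t ≥ 0 or only for a finite time interval [0,T)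
depending on the initial data»; ¶3 «even if there were a finite T …, the uniqueness would exist in at
least a small interval of time»): for every `ν > 0`, every smooth divergence-free datum of class (4) and
every smooth force of class (5), `UniqAt ν u₀ f`. LOAD-BEARING (consumed by `claim_of_steps`).
[claim: Godoi2016, status: under-review] [cite: Godoi2016, p.8 col.2 ¶1–¶3] -/
def UniqLocal : Prop :=
  ∀ ν : ℝ, 0 < ν → ∀ (u₀ : R3 → R3) (f : ℝ → R3 → R3),
    ContDiff ℝ ∞ u₀ → NSWave0.IsDivFree u₀ → HasRapidSpatialDecay u₀ →
    IsSmoothOnHalfSpace f → HasRapidSpaceTimeDecay f → UniqAt ν u₀ f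

/-- **Step 2 — GLOBAL uniqueness grain** (p.8 col.2 ¶3 «there can be no "blowup time" in the examples we
gave, therefore the solutions found in the previous cases are unique at all times (unless pressure)»):
same data classes, the two velocities agree for all `t ≥ 0`. Implies the local grain
(`uniqLocal_of_uniqGlobal`). [claim: Godoi2016, status: under-review] [cite: Godoi2016, p.8 col.2 ¶3] -/
def UniqGlobal : Prop :=
  ∀ ν : ℝ, 0 < ν → ∀ (u₀ : R3 → R3) (f : ℝ → R3 → R3),
    ContDiff ℝ ∞ u₀ → NSWave0.IsDivFree u₀ → HasRapidSpatialDecay u₀ →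
    IsSmoothOnHalfSpace f → HasRapidSpaceTimeDecay f →
    ∀ (u v : ℝ → R3 → R3) (p q : ℝ → R3 → ℝ),
      IsSmoothOnHalfSpace u → IsSmoothOnHalfSpace p → IsNavierStokesSolution ν f u₀ u p →
      IsSmoothOnHalfSpace v → IsSmoothOnHalfSpace q → IsNavierStokesSolution ν f u₀ v q →
        ∀ t : ℝ, 0 ≤ t → u t = v t

/-! ## Kernel facts about Example 1 -/

/-- `w(0) = 0`. [cite: Godoi2016, (13.2) p.2 col.2 «v(0) = 0»] -/
theorem w_zero : w 0 = 0 := by simp [w]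

/-- `w(t) > 0` for `t > 0` («v(t) ≠ 0, t > 0», p.2 col.2). [cite: Godoi2016, (13.2) p.2 col.2] -/
theorem w_pos {t : ℝ} (ht : 0 < t) : 0 < w t := by
  have h1 : Real.exp (-t) < 1 := Real.exp_lt_one_iff.mpr (by linarith)
  exact mul_pos (Real.exp_pos _) (by linarith)

/-- `w` is smooth. [cite: Godoi2016, (13.2) p.2 col.2] -/
theorem contDiff_w : ContDiff ℝ ∞ w :=
  (Real.contDiff_exp.comp contDiff_neg).mul (contDiff_const.sub (Real.contDiff_exp.comp contDiff_neg))

/-- `(1,1,1) ≠ 0` (so `v(t) ≠ 0` for `t > 0`). [cite: Godoi2016, (13.2) p.2 col.2 «v(t) ≠ 0, t > 0»] -/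
theorem diag_ne_zero : diag ≠ 0 := by
  intro h
  have := congrArg (fun v : R3 => v 0) h
  simp [diag] at this

/-- The drift profile is smooth. [cite: Godoi2016, (13.2) p.2 col.2] -/
theorem contDiff_drift : ContDiff ℝ ∞ drift := contDiff_w.smul contDiff_const

/-- `v(0) = 0`. [cite: Godoi2016, (13.2) p.2 col.2] -/
theorem drift_zero : drift 0 = 0 := by simp [drift, w_zero]

/-- `v(t) ≠ 0` for `t > 0`. [cite: Godoi2016, p.2 col.2 «v(t) ≠ 0, t > 0»] -/
theorem drift_ne_zero {t : ℝ} (ht : 0 < t) : drift t ≠ 0 :=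
  smul_ne_zero (w_pos ht).ne' diag_ne_zero

/-- With `u⁰ ≡ 0` («Simpler it would be to choose u⁰(x) = 0», p.2 col.2) the velocity (13.3) is the
parasitic drift `u(t,x) = v(t)` of the tree. [cite: Godoi2016, (13.3) p.2 col.2] -/
theorem velocity1_zero : velocity1 0 = driftVelocity drift := by
  funext t x; simp [velocity1, driftVelocity]

/-- With `θ ≡ 0` the pressure (15) is the drift pressure `−⟪v′(t), x⟫ = −w′(t)(x₁ + x₂ + x₃)` of the
tree. [cite: Godoi2016, (14)–(15) p.2 col.2] -/
theorem pressure1_zero : pressure1 0 = driftPressure drift := by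
  funext t x
  have hd : deriv drift t = deriv w t • diag := by
    show deriv (fun s => w s • diag) t = deriv w t • diag
    exact deriv_smul_const (contDiff_w.differentiable (by simp)).differentiableAt diag
  simp only [pressure1, driftPressure, hd, Pi.zero_apply, add_zero, inner_smul_left, RCLike.conj_to_real]
  simp [diag, PiLp.inner_apply, Fin.sum_univ_three]

/-- With `u⁰ ≡ 0` the force (13.4) vanishes: `f ≡ 0` (every term of (13.4) carries `u⁰` or `Du⁰`).
[cite: Godoi2016, (13.4) p.2 col.2] -/
theorem force1_zero (ν : ℝ) : force1 ν 0 = 0 := by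
  funext t x
  have h0 : (0 : R3 → R3) = fun _ => (0 : R3) := rfl
  simp only [force1, Pi.zero_apply, neg_zero, h0, InnerProductSpace.laplacian_const]
  simp

/-- **Step 1 in its simplest printed instance, PROVED** («Simpler it would be to choose u⁰(x) = 0», p.2
col.2, in (13.1)–(16); `θ ≡ 0` in (15)): at every viscosity the datum `u⁰ ≡ 0` is a Clay datum (4), the
force (13.4) is `≡ 0` (of class (5)), `(u, p) = (v(t), −w′(t)(x₁+x₂+x₃))` is smooth on `ℝ³ × [0,∞)`, solves
(1), (2), (3) with these data, and `∫|u(x,t)|²dx = ∞` for every `t > 0` (so (7) fails). Kernel: the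
parasitic drift of KNSS 2009 §1. [cite: Godoi2016, (13.1)–(16) p.2 col.2] -/
theorem example1_zero (ν : ℝ) :
    ContDiff ℝ ∞ (0 : R3 → R3) ∧ NSWave0.IsDivFree (0 : R3 → R3) ∧ HasRapidSpatialDecay (0 : R3 → R3) ∧
    IsSmoothOnHalfSpace (force1 ν 0) ∧ clayR3.force (force1 ν 0) ∧
    IsSmoothOnHalfSpace (velocity1 0) ∧ IsSmoothOnHalfSpace (pressure1 0) ∧
    IsNavierStokesSolution ν (force1 ν 0) 0 (velocity1 0) (pressure1 0) ∧
      ∀ t : ℝ, 0 < t → ∫⁻ x, ‖velocity1 0 t x‖ₑ ^ 2 = ⊤ := by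
  obtain ⟨h1, h2, h3⟩ := clayDatum_zero
  rw [force1_zero, velocity1_zero, pressure1_zero]
  refine ⟨h1, h2, h3, isSmoothOnHalfSpace_zero, clayR3_force_zero,
    isSmoothOnHalfSpace_driftVelocity contDiff_drift, isSmoothOnHalfSpace_driftPressure contDiff_drift,
    ?_, fun t ht => lintegral_enorm_sq_driftVelocity (drift_ne_zero ht)⟩
  have h := isNavierStokesSolution_drift (contDiff_drift.of_le (by exact_mod_cast le_top)) ν
  have h0 : (fun _ : R3 => drift 0) = (0 : R3 → R3) := by funext x; simp [drift_zero]
  rwa [h0] at h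

/-! ## Kernel composition -/

/-- **Step 3, PROVED given Step 2 at the data** (p.8 col.2 ¶3 «the uniqueness would exist in at least a
small interval of time, which is enough to show that in this time range occurs the breakdown of
Navier-Stokes solutions because it was disobeyed the limited kinetic energy condition (7), making the
case (C) true»): a solution of (1)(2)(3), smooth on the half-space, with infinite energy at every `t > 0`,
together with `UniqAt` for its data, excludes every Clay-sense solution for these data.
[cite: Godoi2016, p.8 col.2 ¶3] -/
theorem not_solvable_of_badSolution {ν : ℝ} {u₀ : R3 → R3} {f : ℝ → R3 → R3} {u : ℝ → R3 → R3}
    {p : ℝ → R3 → ℝ} (hu : IsSmoothOnHalfSpace u) (hp : IsSmoothOnHalfSpace p)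
    (hns : IsNavierStokesSolution ν f u₀ u p) (hbad : ∀ t : ℝ, 0 < t → ∫⁻ x, ‖u t x‖ₑ ^ 2 = ⊤)
    (huniq : UniqAt ν u₀ f) : NoAdmissibleSolution ν u₀ f := by
  rintro ⟨v, q, hv, hq, hvns, C, hC, hE⟩
  obtain ⟨T, hT, heq⟩ := huniq u v p q hu hp hns hv hq hvns
  have hmem : T / 2 ∈ Ico 0 T := ⟨by positivity, by linarith⟩
  have h1 := hE (T / 2) (by positivity)
  rw [← heq (T / 2) hmem, hbad (T / 2) (by positivity)] at h1
  exact (lt_irrefl _) (lt_of_le_of_lt h1 hC)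

/-- **COMPOSITION** (Examples p.2–8 + uniqueness p.8 col.2 ⇒ (C)): Step 1 (Example 1 with the datum
(13.1), `θ ≡ 0`) and Step 2 (local uniqueness at its data) give the claimed theorem, the witnesses being
`(u⁰, f)` of (13.1)/(13.4). Pure logic over `not_solvable_of_badSolution`. [cite: Godoi2016, p.8 col.1–2] -/
theorem claim_of_steps (h₁ : Example1) (h₂ : UniqLocal) : ClaimedTheorem := by
  intro ν hν
  obtain ⟨hd, hdiv, hdec, hf, hfdec, hu, hp, hns, hbad⟩ := h₁ ν hν 0 contDiff_const
  exact ClaySpec.BreakdownAt.of_not_solvable (S := clayR3) hd hdiv hdec hf hfdec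
    (not_solvable_of_badSolution hu hp hns hbad (h₂ ν hν _ _ hd hdiv hdec hf hfdec))

/-- **COMPOSITION through the proved instance**: Step 2 alone (local uniqueness, instantiated at the
paper's simplest data `u⁰ ≡ 0`, `f ≡ 0` of Example 1) gives the claimed theorem — the whole weight of the
claim rests on Step 2. [cite: Godoi2016, p.2 col.2 «Simpler it would be to choose u⁰(x) = 0»; p.8 col.2] -/
theorem claim_of_uniqAt_zero (h : ∀ ν : ℝ, 0 < ν → UniqAt ν 0 0) : ClaimedTheorem := by
  intro ν hν
  obtain ⟨hd, hdiv, hdec, hf, hfC, hu, hp, hns, hbad⟩ := example1_zero ν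
  have hns' : IsNavierStokesSolution ν 0 0 (velocity1 0) (pressure1 0) := by rwa [force1_zero] at hns
  exact ClaySpec.BreakdownAt.of_not_solvable (S := clayR3) hd hdiv hdec isSmoothOnHalfSpace_zero
    clayR3_force_zero (not_solvable_of_badSolution hu hp hns' hbad (h ν hν))

/-- `UniqLocal → ClaimedTheorem` (via `claim_of_uniqAt_zero`). [cite: Godoi2016, p.8 col.2] -/
theorem claim_of_uniq (h : UniqLocal) : ClaimedTheorem := by
  refine claim_of_uniqAt_zero fun ν hν => ?_
  obtain ⟨hd, hdiv, hdec, -, -⟩ := example1_zero ν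
  exact h ν hν 0 0 hd hdiv hdec isSmoothOnHalfSpace_zero clayR3_force_zero

/-- The global uniqueness grain implies the local one. [cite: Godoi2016, p.8 col.2 ¶3] -/
theorem uniqLocal_of_uniqGlobal (h : UniqGlobal) : UniqLocal := by
  intro ν hν u₀ f hd hdiv hdec hf hfdec u v p q hu hp hns hv hq hvns
  exact ⟨1, one_pos, fun t ht => h ν hν u₀ f hd hdiv hdec hf hfdec u v p q hu hp hns hv hq hvns t ht.1⟩

/-! ## Example 1 verified for every `C²` divergence-free profile (rev 2, additive) -/

/-- The gradient of `y ↦ ⟪c, y⟫` is `c`. [folklore] -/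
private theorem gradient_inner_const_left (c x : R3) : gradient (fun y : R3 => ⟪c, y⟫) x = c := by
  have h : HasFDerivAt (fun y : R3 => ⟪c, y⟫) (innerSL ℝ c) x := (innerSL ℝ c).hasFDerivAt
  rw [gradient, h.fderiv]
  apply (InnerProductSpace.toDual ℝ R3).injective
  rw [LinearIsometryEquiv.apply_symm_apply]
  ext y
  simp [InnerProductSpace.toDual_apply_apply]

/-- (15) differs from the drift pressure `−⟪v′(t), x⟫` of the tree by the constant `θ(t)`.
[cite: Godoi2016, (14)–(15) p.2 col.2] -/
theorem pressure1_eq (θ : ℝ → ℝ) (t : ℝ) (x : R3) :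
    pressure1 θ t x = driftPressure drift t x + θ t := by
  have h := congrFun (congrFun pressure1_zero t) x
  simp only [pressure1, Pi.zero_apply, add_zero] at h
  simp [pressure1, h]

/-- (14): `∇p = −∂v/∂t` for the pressure (15), whatever `θ`. [cite: Godoi2016, (14)–(15) p.2 col.2] -/
theorem gradient_pressure1 (θ : ℝ → ℝ) (t : ℝ) (x : R3) :
    gradient (pressure1 θ t) x = -deriv drift t := by
  have h1 : pressure1 θ t = fun y => ⟪-deriv drift t, y⟫ + θ t := by
    funext y; rw [pressure1_eq]; simp [driftPressure, inner_neg_left]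
  rw [h1, gradient, fderiv_add_const, ← gradient, gradient_inner_const_left]

/-- `∂ₜu = −e^{−t}u⁰(x) + v′(t)` for the velocity (13.3) (one-sided derivative within `[0,∞)` at
`t ≥ 0`). [cite: Godoi2016, (13.3) p.2 col.2] -/
theorem derivWithin_velocity1 (u₀ : R3 → R3) {t : ℝ} (ht : 0 ≤ t) (x : R3) :
    derivWithin (fun s => velocity1 u₀ s x) (Ici 0) t = -(Real.exp (-t)) • u₀ x + deriv drift t := by
  have h1 : HasDerivAt (fun s : ℝ => Real.exp (-s)) (-(Real.exp (-t))) t := by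
    have h := ((hasDerivAt_id t).neg).exp
    simp only [mul_neg, mul_one] at h
    exact h
  have h2 : HasDerivAt drift (deriv drift t) t :=
    ((contDiff_drift.differentiable (by simp)).differentiableAt).hasDerivAt
  have h : HasDerivAt (fun s => velocity1 u₀ s x) (-(Real.exp (-t)) • u₀ x + deriv drift t) t :=
    (h1.smul_const (u₀ x)).add h2
  exact h.hasDerivWithinAt.derivWithin (uniqueDiffOn_Ici 0 t ht)

/-- `Du(t,·)(x) = e^{−t} Du⁰(x)` for the velocity (13.3). [cite: Godoi2016, (13.3) p.2 col.2] -/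
theorem fderiv_velocity1 {u₀ : R3 → R3} (hu : Differentiable ℝ u₀) (t : ℝ) (x : R3) :
    fderiv ℝ (velocity1 u₀ t) x = Real.exp (-t) • fderiv ℝ u₀ x := by
  have h : velocity1 u₀ t = fun y => Real.exp (-t) • u₀ y + drift t := rfl
  rw [h, fderiv_add_const, fderiv_fun_const_smul (hu x)]

/-- `Δu(t,·)(x) = e^{−t} Δu⁰(x)` for the velocity (13.3). [cite: Godoi2016, (13.3) p.2 col.2] -/
theorem laplacian_velocity1 {u₀ : R3 → R3} (hu : ContDiff ℝ 2 u₀) (t : ℝ) (x : R3) :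
    Δ (velocity1 u₀ t) x = Real.exp (-t) • Δ u₀ x := by
  have h : velocity1 u₀ t = (Real.exp (-t) • u₀) + fun _ => drift t := by
    funext y; simp [velocity1]
  have h1 : ContDiffAt ℝ 2 (Real.exp (-t) • u₀) x :=
    (hu.const_smul (Real.exp (-t))).contDiffAt (x := x)
  have h2 : ContDiffAt ℝ 2 (fun _ : R3 => drift t) x := contDiffAt_const
  rw [h, h1.laplacian_add h2, InnerProductSpace.laplacian_smul _ hu.contDiffAt,
    InnerProductSpace.laplacian_const]
  simp

/-- **Example 1 solves the Navier–Stokes system for EVERY `C²` divergence-free profile `u⁰`**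
(direct substitution, as the paper says p.8 col.2 «guaranteed by construction and direct
substitution»): with the force (13.4) and the pressure (15) (any `θ`), the velocity (13.3) satisfies
(1), (2), (3) with datum `u⁰`, at every viscosity. [cite: Godoi2016, (13.1)–(15) p.2 col.2; p.8 col.2] -/
theorem isNavierStokesSolution_velocity1 (ν : ℝ) {u₀ : R3 → R3} (hu : ContDiff ℝ 2 u₀)
    (hdiv : NSWave0.IsDivFree u₀) (θ : ℝ → ℝ) :
    IsNavierStokesSolution ν (force1 ν u₀) u₀ (velocity1 u₀) (pressure1 θ) where
  momentum t ht x := by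
    have hd : Differentiable ℝ u₀ := hu.differentiable (by simp)
    rw [derivWithin_velocity1 u₀ ht x, fderiv_velocity1 hd, laplacian_velocity1 hu,
      gradient_pressure1]
    have happ : ∀ (c : ℝ) (L : R3 →L[ℝ] R3) (v : R3), (c • L) v = c • L v := fun _ _ _ => rfl
    simp only [velocity1, force1, happ, map_add, map_smul, smul_add, smul_sub, smul_neg, smul_smul]
    module
  divFree t ht x := by
    have hd : Differentiable ℝ u₀ := hu.differentiable (by simp)
    have h := hdiv x
    simp only [NSWave0.divergence] at h ⊢
    rw [fderiv_velocity1 hd, ContinuousLinearMap.toLinearMap_smul, map_smul, h, smul_zero]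
  initial := by
    funext x; simp [velocity1, drift_zero]

/-! ## Example 1 AT THE PRINTED GAUSSIAN DATUM (13.1) — `Example1` discharged
(APPEND-ONLY, cell `ns-claims` typist-12 g5, 2026-08-27; D-0026 own-lineage debt pass; verdict #111 untouched)

The rev-1 file proved Example 1 only in its degenerate instance `u⁰ ≡ 0` (`example1_zero`). Here the printed
datum `u⁰(x) = e^{−|x|²}(x₂x₃, x₁x₃, −2x₁x₂)` itself is treated: it is a Schwartz field (Gaussian × temperate
polynomial, `SchwartzMap.bilinLeftCLM` over the tree's `realGaussianSchwartz`), divergence free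
(`div(gP) = g div P + ⟪P, ∇g⟫`, `⟪x, P(x)⟫ = 0`, `div P = 0`), the force (13.4) is a sum of three tensors
`e^{−mt} ⊗ (Schwartz)`, `m = 1, 2, 3` (the Schwartz algebra: `fderivCLM`, `∂_{(1,1,1)}`, `Δ` on `𝓢`), whence
Fefferman's class (5) by a generic Leibniz/tensor lemma (`spaceTimeDecay_smul`), and `∫|u(t)|² = ∞` for `t > 0`
because `u(t) − e^{−t}u⁰ = v(t)` is a non-zero constant. Generic pieces (`hasRapidSpatialDecay_schwartz`,
`spaceTimeDecay_smul`, `hasRapidSpaceTimeDecay_of_iteratedFDeriv`) are stated on `ℝ³` with values in any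
real normed space. Mathlib: `SchwartzMap.one_add_le_sup_seminorm_apply`, `norm_iteratedFDeriv_smul_le`,
`ContinuousLinearMap.iteratedFDeriv_comp_right`, `Function.HasTemperateGrowth.{mul,smul,add,const}`,
`hasStrictFDerivAt_norm_sq`, `SchwartzMap.laplacian_apply`. -/

section Example1Gaussian

open Literature.Analysis.FunctionSpaces
open scoped Topology SchwartzMap NNReal


variable {F : Type*} [NormedAddCommGroup F] [NormedSpace ℝ F]

/-- A Schwartz function on `ℝ³` has Fefferman's rapid spatial decay (4) — (4) is the Schwartz seminorm
condition `sup (1+|x|)^K |∂^α u⁰| < ∞`. [cite: FeffermanClay2006, (4) p. 1] -/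
theorem hasRapidSpatialDecay_schwartz (f : 𝓢(R3, F)) : HasRapidSpatialDecay (⇑f) := by
  intro n K
  exact ⟨2 ^ K * (Finset.Iic (K, n)).sup (schwartzSeminormFamily ℝ R3 F) f,
    fun x => SchwartzMap.one_add_le_sup_seminorm_apply (m := (K, n)) le_rfl le_rfl f x⟩

/-- Time factors `e^{-m t}`, `m > 0`: all derivatives decay faster than any power on `t ≥ 0`:
`(1 + t)^K · ‖Dʲ e^{-m·}(t)‖ ≤ mʲ (1 + K/m)^K`. [folklore] -/
private theorem pow_mul_norm_iteratedFDeriv_exp_neg_mul_le {m : ℝ} (hm : 0 < m) (j K : ℕ) {t : ℝ}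
    (ht : 0 ≤ t) :
    (1 + t) ^ K * ‖iteratedFDeriv ℝ j (fun s : ℝ => Real.exp (-m * s)) t‖ ≤
      m ^ j * (1 + K / m) ^ K := by
  rw [norm_iteratedFDeriv_exp_const_mul, abs_neg, abs_of_pos hm]
  -- `(1 + t) ≤ (1 + K/m) e^{(m/K) t}` when `K ≥ 1`; trivial when `K = 0`
  rcases Nat.eq_zero_or_pos K with hK | hK
  · subst hK
    simp only [pow_zero, one_mul, Nat.cast_zero, zero_div, add_zero, mul_one]
    have : Real.exp (-m * t) ≤ 1 := by
      rw [Real.exp_le_one_iff]; nlinarith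
    calc m ^ j * Real.exp (-m * t) ≤ m ^ j * 1 := by gcongr
      _ = m ^ j := mul_one _
  · have hKr : (0 : ℝ) < K := by exact_mod_cast hK
    set c : ℝ := m / K with hc
    have hcpos : 0 < c := div_pos hm hKr
    -- 1 + t ≤ (1 + 1/c) * exp (c t)
    have h1 : 1 + t ≤ (1 + 1 / c) * Real.exp (c * t) := by
      have he : c * t + 1 ≤ Real.exp (c * t) := Real.add_one_le_exp _
      have hct : 0 ≤ c * t := mul_nonneg hcpos.le ht
      have : (1 + 1 / c) * (c * t + 1) = 1 + t + (c * t + 1 / c) := by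
        field_simp
        ring
      nlinarith [this, hcpos, one_div_pos.2 hcpos]
    have h2 : (1 + t) ^ K ≤ (1 + 1 / c) ^ K * Real.exp (m * t) := by
      calc (1 + t) ^ K ≤ ((1 + 1 / c) * Real.exp (c * t)) ^ K :=
            pow_le_pow_left₀ (by linarith) h1 K
        _ = (1 + 1 / c) ^ K * Real.exp (c * t) ^ K := mul_pow _ _ _
        _ = (1 + 1 / c) ^ K * Real.exp (m * t) := by
            rw [← Real.exp_nat_mul, hc]
            congr 2
            field_simp
    have h1c : 1 + 1 / c = 1 + K / m := by rw [hc, one_div_div]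
    calc (1 + t) ^ K * (m ^ j * Real.exp (-m * t))
        ≤ (1 + 1 / c) ^ K * Real.exp (m * t) * (m ^ j * Real.exp (-m * t)) := by
          gcongr
      _ = m ^ j * (1 + K / m) ^ K * (Real.exp (m * t) * Real.exp (-m * t)) := by rw [h1c]; ring
      _ = m ^ j * (1 + K / m) ^ K := by rw [← Real.exp_add]; simp

/-- From plain space-time derivative bounds on `[0,∞) × ℝ³` for a globally smooth field to
Fefferman's decay class (5) (the `iteratedFDerivWithin` on the half-space agrees with `iteratedFDeriv`
there): the membership test for Fefferman's class (5). [cite: FeffermanClay2006, (5) p. 1] -/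
theorem hasRapidSpaceTimeDecay_of_iteratedFDeriv {f : ℝ → R3 → F}
    (hs : ContDiff ℝ ∞ (Function.uncurry f))
    (hd : ∀ n K : ℕ, ∃ C : ℝ, ∀ t : ℝ, 0 ≤ t → ∀ x : R3,
      (1 + ‖x‖ + t) ^ K * ‖iteratedFDeriv ℝ n (Function.uncurry f) (t, x)‖ ≤ C) :
    HasRapidSpaceTimeDecay f := by
  intro n K
  obtain ⟨C, hC⟩ := hd n K
  refine ⟨C, fun t ht x => ?_⟩
  have hU : UniqueDiffOn ℝ (Set.Ici (0:ℝ) ×ˢ (Set.univ : Set R3)) :=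
    (uniqueDiffOn_Ici 0).prod uniqueDiffOn_univ
  rw [iteratedFDerivWithin_eq_iteratedFDeriv hU
    ((hs.of_le (by exact_mod_cast le_top)).contDiffAt)
    (Set.mk_mem_prod (Set.mem_Ici.2 ht) (Set.mem_univ x))]
  exact hC t ht x

/-- Smoothness on the half-space of a globally smooth field. [folklore] -/
private theorem isSmoothOnHalfSpace_of_contDiff {f : ℝ → R3 → F} (hs : ContDiff ℝ ∞ (Function.uncurry f)) :
    IsSmoothOnHalfSpace f :=
  hs.contDiffOn

/-- **Tensor products decay**: for a smooth time factor `a` all of whose derivatives decay faster than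
any power on `t ≥ 0`, and a Schwartz space factor `b`, the field `(t, x) ↦ a(t) • b(x)` has all space-time
derivatives bounded by `C (1 + ‖x‖ + t)^{-K}` on `[0,∞) × ℝ³` (Leibniz rule + `Dⁱ(a ∘ fst) = Dⁱa ∘ fst`), i.e.
the derivative bounds of Fefferman's class (5) for such tensors. [cite: FeffermanClay2006, (5) p. 1] -/
theorem spaceTimeDecay_smul {a : ℝ → ℝ} (ha : ContDiff ℝ ∞ a)
    (hadec : ∀ j K : ℕ, ∃ C : ℝ, ∀ t : ℝ, 0 ≤ t → (1 + t) ^ K * ‖iteratedFDeriv ℝ j a t‖ ≤ C)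
    (b : 𝓢(R3, F)) (n K : ℕ) :
    ∃ C : ℝ, ∀ t : ℝ, 0 ≤ t → ∀ x : R3,
      (1 + ‖x‖ + t) ^ K * ‖iteratedFDeriv ℝ n (fun p : ℝ × R3 => a p.1 • b p.2) (t, x)‖ ≤ C := by
  choose A hA using fun j => hadec j K
  choose B hB using fun j => hasRapidSpatialDecay_schwartz b j K
  refine ⟨∑ i ∈ Finset.range (n + 1), (n.choose i : ℝ) * A i * B (n - i), fun t ht x => ?_⟩
  have hfa : ContDiff ℝ ∞ (fun p : ℝ × R3 => a p.1) := ha.comp contDiff_fst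
  have hfb : ContDiff ℝ ∞ (fun p : ℝ × R3 => b p.2) := (b.smooth ⊤).comp contDiff_snd
  have hleib := norm_iteratedFDeriv_smul_le (𝕜 := ℝ) hfa hfb (t, x) (n := n) (by exact_mod_cast le_top)
  -- the factors through the projections
  have h1 : ∀ i : ℕ, ‖iteratedFDeriv ℝ i (fun p : ℝ × R3 => a p.1) (t, x)‖ ≤ ‖iteratedFDeriv ℝ i a t‖ := by
    intro i
    have hcomp : (fun p : ℝ × R3 => a p.1) = a ∘ (ContinuousLinearMap.fst ℝ ℝ R3) := rfl
    rw [hcomp, ContinuousLinearMap.iteratedFDeriv_comp_right (n := ∞) _ ha _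
      (by exact_mod_cast le_top)]
    refine (ContinuousMultilinearMap.norm_compContinuousLinearMap_le _ _).trans ?_
    have hprod : ∏ _ : Fin i, ‖ContinuousLinearMap.fst ℝ ℝ R3‖ ≤ 1 :=
      Finset.prod_le_one (fun _ _ => norm_nonneg _) (fun _ _ => ContinuousLinearMap.norm_fst_le ℝ ℝ R3)
    calc ‖iteratedFDeriv ℝ i a ((ContinuousLinearMap.fst ℝ ℝ R3) (t, x))‖ *
          ∏ _ : Fin i, ‖ContinuousLinearMap.fst ℝ ℝ R3‖
        ≤ ‖iteratedFDeriv ℝ i a t‖ * 1 := by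
          refine mul_le_mul le_rfl hprod (Finset.prod_nonneg fun _ _ => norm_nonneg _) (norm_nonneg _)
      _ = ‖iteratedFDeriv ℝ i a t‖ := mul_one _
  have h2 : ∀ i : ℕ, ‖iteratedFDeriv ℝ i (fun p : ℝ × R3 => b p.2) (t, x)‖ ≤ ‖iteratedFDeriv ℝ i b x‖ := by
    intro i
    have hcomp : (fun p : ℝ × R3 => b p.2) = ⇑b ∘ (ContinuousLinearMap.snd ℝ ℝ R3) := rfl
    rw [hcomp, ContinuousLinearMap.iteratedFDeriv_comp_right (n := ∞) _ (b.smooth ⊤) _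
      (by exact_mod_cast le_top)]
    refine (ContinuousMultilinearMap.norm_compContinuousLinearMap_le _ _).trans ?_
    have hprod : ∏ _ : Fin i, ‖ContinuousLinearMap.snd ℝ ℝ R3‖ ≤ 1 :=
      Finset.prod_le_one (fun _ _ => norm_nonneg _) (fun _ _ => ContinuousLinearMap.norm_snd_le ℝ ℝ R3)
    calc ‖iteratedFDeriv ℝ i b ((ContinuousLinearMap.snd ℝ ℝ R3) (t, x))‖ *
          ∏ _ : Fin i, ‖ContinuousLinearMap.snd ℝ ℝ R3‖
        ≤ ‖iteratedFDeriv ℝ i b x‖ * 1 := by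
          refine mul_le_mul le_rfl hprod (Finset.prod_nonneg fun _ _ => norm_nonneg _) (norm_nonneg _)
      _ = ‖iteratedFDeriv ℝ i b x‖ := mul_one _
  -- weights split
  have hw : (1 + ‖x‖ + t) ^ K ≤ (1 + t) ^ K * (1 + ‖x‖) ^ K := by
    rw [← mul_pow]
    apply pow_le_pow_left₀ (by positivity)
    nlinarith [norm_nonneg x, ht]
  calc (1 + ‖x‖ + t) ^ K * ‖iteratedFDeriv ℝ n (fun p : ℝ × R3 => a p.1 • b p.2) (t, x)‖
      ≤ ((1 + t) ^ K * (1 + ‖x‖) ^ K) *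
          ∑ i ∈ Finset.range (n + 1), (n.choose i : ℝ) *
            ‖iteratedFDeriv ℝ i (fun p : ℝ × R3 => a p.1) (t, x)‖ *
            ‖iteratedFDeriv ℝ (n - i) (fun p : ℝ × R3 => b p.2) (t, x)‖ :=
        mul_le_mul hw hleib (norm_nonneg (iteratedFDeriv ℝ n (fun p : ℝ × R3 => a p.1 • b p.2) (t, x)))
          (by positivity)
    _ = ∑ i ∈ Finset.range (n + 1), (n.choose i : ℝ) *
          ((1 + t) ^ K * ‖iteratedFDeriv ℝ i (fun p : ℝ × R3 => a p.1) (t, x)‖) *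
          ((1 + ‖x‖) ^ K * ‖iteratedFDeriv ℝ (n - i) (fun p : ℝ × R3 => b p.2) (t, x)‖) := by
        rw [Finset.mul_sum]
        refine Finset.sum_congr rfl fun i _ => ?_
        ring
    _ ≤ ∑ i ∈ Finset.range (n + 1), (n.choose i : ℝ) * A i * B (n - i) := by
        refine Finset.sum_le_sum fun i _ => ?_
        have ha' : (1 + t) ^ K * ‖iteratedFDeriv ℝ i (fun p : ℝ × R3 => a p.1) (t, x)‖ ≤ A i :=
          le_trans (mul_le_mul_of_nonneg_left (h1 i) (by positivity)) (hA i t ht)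
        have hb' : (1 + ‖x‖) ^ K * ‖iteratedFDeriv ℝ (n - i) (fun p : ℝ × R3 => b p.2) (t, x)‖ ≤
            B (n - i) :=
          le_trans (mul_le_mul_of_nonneg_left (h2 (n - i)) (by positivity)) (hB (n - i) x)
        have hA0 : 0 ≤ A i := le_trans (by positivity) ha'
        have hB0 : 0 ≤ B (n - i) := le_trans (by positivity) hb'
        have key := mul_le_mul ha' hb' (by positivity) hA0
        calc (n.choose i : ℝ) * ((1 + t) ^ K * ‖iteratedFDeriv ℝ i (fun p : ℝ × R3 => a p.1) (t, x)‖) *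
              ((1 + ‖x‖) ^ K * ‖iteratedFDeriv ℝ (n - i) (fun p : ℝ × R3 => b p.2) (t, x)‖)
            = (n.choose i : ℝ) * (((1 + t) ^ K * ‖iteratedFDeriv ℝ i (fun p : ℝ × R3 => a p.1) (t, x)‖) *
              ((1 + ‖x‖) ^ K * ‖iteratedFDeriv ℝ (n - i) (fun p : ℝ × R3 => b p.2) (t, x)‖)) := by ring
          _ ≤ (n.choose i : ℝ) * (A i * B (n - i)) := mul_le_mul_of_nonneg_left key (Nat.cast_nonneg _)
          _ = (n.choose i : ℝ) * A i * B (n - i) := by ring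

/-! ### The printed datum (13.1) as a Schwartz map; divergence -/

open scoped RealInnerProductSpace

/-- The polynomial factor of (13.1): `P(x) = (x₂x₃, x₁x₃, −2x₁x₂)` (coordinates `x 0, x 1, x 2`).
[cite: Godoi2016, (13.1) p.2 col.2] -/
def poly1 (x : R3) : R3 := !₂[x 1 * x 2, x 0 * x 2, -2 * x 0 * x 1]

/-- `u⁰ = e^{−|x|²} P`. [cite: Godoi2016, (13.1) p.2 col.2] -/
theorem datum1_eq_smul_poly1 : datum1 = fun x : R3 => Real.exp (-(‖x‖ ^ 2)) • poly1 x := rfl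

/-- The coordinate functions have temperate growth (they are continuous linear). [folklore] -/
private theorem hasTemperateGrowth_coord (i : Fin 3) : Function.HasTemperateGrowth (fun x : R3 => x i) :=
  (EuclideanSpace.proj (𝕜 := ℝ) i).hasTemperateGrowth

/-- The polynomial factor has temperate growth. [cite: Godoi2016, (13.1) p.2 col.2] -/
theorem hasTemperateGrowth_poly1 : Function.HasTemperateGrowth poly1 := by
  have hc := hasTemperateGrowth_coord
  have h0 := ((hc 1).mul (hc 2)).smul
    (Function.HasTemperateGrowth.const (E := R3) (EuclideanSpace.single (0 : Fin 3) (1 : ℝ)))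
  have h1 := ((hc 0).mul (hc 2)).smul
    (Function.HasTemperateGrowth.const (E := R3) (EuclideanSpace.single (1 : Fin 3) (1 : ℝ)))
  have h2 := (((Function.HasTemperateGrowth.const (E := R3) (-2 : ℝ)).mul (hc 0)).mul (hc 1)).smul
    (Function.HasTemperateGrowth.const (E := R3) (EuclideanSpace.single (2 : Fin 3) (1 : ℝ)))
  convert (h0.add h1).add h2 using 1
  funext x
  ext i
  fin_cases i <;> simp [poly1]

/-- The polynomial factor is smooth. [cite: Godoi2016, (13.1) p.2 col.2] -/
theorem contDiff_poly1 : ContDiff ℝ ∞ poly1 := hasTemperateGrowth_poly1.1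

/-- **The datum (13.1) as a Schwartz map** (Gaussian × temperate polynomial).
[cite: Godoi2016, (13.1) p.2 col.2, «u⁰(x) ∈ S(ℝ³)»] -/
def datum1S : 𝓢(R3, R3) :=
  SchwartzMap.bilinLeftCLM (ContinuousLinearMap.lsmul ℝ ℝ) hasTemperateGrowth_poly1
    (realGaussianSchwartz R3 1)

/-- The Schwartz map `datum1S` is the datum (13.1). [cite: Godoi2016, (13.1) p.2 col.2] -/
theorem coe_datum1S : ⇑datum1S = datum1 := by
  funext x
  simp only [datum1S, SchwartzMap.bilinLeftCLM_apply, realGaussianSchwartz_apply one_pos,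
    ContinuousLinearMap.lsmul_apply, datum1_eq_smul_poly1, neg_mul, one_mul]

/-- The datum (13.1) is smooth. [cite: Godoi2016, (13.1) p.2 col.2] -/
theorem contDiff_datum1 : ContDiff ℝ ∞ datum1 := coe_datum1S ▸ datum1S.smooth ⊤

/-- The datum (13.1) has Fefferman's decay (4) («u⁰(x) ∈ S(ℝ³)», p.2 col.2).
[cite: Godoi2016, (13.1) p.2 col.2] -/
theorem hasRapidSpatialDecay_datum1 : HasRapidSpatialDecay datum1 :=
  coe_datum1S ▸ hasRapidSpatialDecay_schwartz datum1S

/-- `⟪x, P(x)⟫ = x₁x₂x₃ + x₂x₁x₃ − 2x₃x₁x₂ = 0`. [cite: Godoi2016, (13.1) p.2 col.2] -/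
theorem inner_self_poly1 (x : R3) : ⟪x, poly1 x⟫ = 0 := by
  simp [poly1, PiLp.inner_apply, Fin.sum_univ_three]
  ring

/-- `div P = ∂₁(x₂x₃) + ∂₂(x₁x₃) + ∂₃(−2x₁x₂) = 0`. [cite: Godoi2016, (13.1) p.2 col.2] -/
theorem divergence_poly1 (x : R3) : VectorCalculus.divergence poly1 x = 0 := by
  have hd : DifferentiableAt ℝ poly1 x := (contDiff_poly1.differentiable (by simp)).differentiableAt
  rw [divergence_eq_sum_three, ← fderiv_apply_coord_vec3 hd 0, ← fderiv_apply_coord_vec3 hd 1,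
    ← fderiv_apply_coord_vec3 hd 2]
  have hc : ∀ i : Fin 3, HasFDerivAt (⇑(EuclideanSpace.proj (𝕜 := ℝ) i : R3 →L[ℝ] ℝ))
      (EuclideanSpace.proj (𝕜 := ℝ) i : R3 →L[ℝ] ℝ) x := fun i =>
    (EuclideanSpace.proj (𝕜 := ℝ) i : R3 →L[ℝ] ℝ).hasFDerivAt
  have hpr : ∀ (i : Fin 3) (y : R3), (EuclideanSpace.proj (𝕜 := ℝ) i : R3 →L[ℝ] ℝ) y = y i :=
    fun i y => rfl
  have e0 : (fun y : R3 => poly1 y 0) =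
      (⇑(EuclideanSpace.proj (𝕜 := ℝ) (1 : Fin 3) : R3 →L[ℝ] ℝ) *
        ⇑(EuclideanSpace.proj (𝕜 := ℝ) (2 : Fin 3) : R3 →L[ℝ] ℝ)) := by
    funext y; simp [poly1]
  have e1 : (fun y : R3 => poly1 y 1) =
      (⇑(EuclideanSpace.proj (𝕜 := ℝ) (0 : Fin 3) : R3 →L[ℝ] ℝ) *
        ⇑(EuclideanSpace.proj (𝕜 := ℝ) (2 : Fin 3) : R3 →L[ℝ] ℝ)) := by
    funext y; simp [poly1]
  have e2 : (fun y : R3 => poly1 y 2) =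
      ((fun y : R3 => (-2 : ℝ) * (EuclideanSpace.proj (𝕜 := ℝ) (0 : Fin 3) : R3 →L[ℝ] ℝ) y) *
        ⇑(EuclideanSpace.proj (𝕜 := ℝ) (1 : Fin 3) : R3 →L[ℝ] ℝ)) := by
    funext y; simp [poly1, hpr]
  rw [e0, e1, e2, ((hc 1).mul (hc 2)).fderiv, ((hc 0).mul (hc 2)).fderiv,
    (((hc 0).const_mul (-2 : ℝ)).mul (hc 1)).fderiv]
  simp [hpr]

/-- **The datum (13.1) is divergence free**: `div(e^{−|x|²}P) = e^{−|x|²} div P + ⟪P, ∇e^{−|x|²}⟫ =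
0 − 2e^{−|x|²}⟪P, x⟫ = 0`. [cite: Godoi2016, (13.1) p.2 col.2, «∇·u⁰ = 0»] -/
theorem isDivFree_datum1 : NSWave0.IsDivFree datum1 := by
  intro x
  change VectorCalculus.divergence datum1 x = 0
  have hn : HasFDerivAt (fun y : R3 => ‖y‖ ^ 2) (2 • innerSL ℝ x) x :=
    (hasStrictFDerivAt_norm_sq x).hasFDerivAt
  have hθ : HasFDerivAt (fun y : R3 => Real.exp (-(‖y‖ ^ 2)))
      ((-(2 * Real.exp (-(‖x‖ ^ 2)))) • innerSL ℝ x) x := by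
    refine ((hn.neg.exp).congr_fderiv ?_ : HasFDerivAt (fun y : R3 => Real.exp (-(‖y‖ ^ 2))) _ x)
    ext y
    simp
    ring
  have hP : DifferentiableAt ℝ poly1 x := (contDiff_poly1.differentiable (by simp)).differentiableAt
  rw [datum1_eq_smul_poly1, divergence_smul_apply hθ.differentiableAt hP, divergence_poly1, mul_zero,
    zero_add, hθ.hasGradientAt.gradient, real_inner_comm, InnerProductSpace.toDual_symm_apply]
  simp [inner_self_poly1]

/-! ### The force (13.4) at the datum: Schwartz space factors and `e^{−mt}` time factors -/

/-- `x ↦ Du⁰(x)[u⁰(x)]` as a Schwartz map. [cite: Godoi2016, (13.4) p.2 col.2] -/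
def convS : 𝓢(R3, R3) :=
  SchwartzMap.bilinLeftCLM (ContinuousLinearMap.id ℝ (R3 →L[ℝ] R3)) datum1S.hasTemperateGrowth
    (SchwartzMap.fderivCLM ℝ R3 R3 datum1S)

/-- Values of `convS`. [cite: Godoi2016, (13.4) p.2 col.2] -/
theorem convS_apply (x : R3) : convS x = fderiv ℝ datum1 x (datum1 x) := by
  simp only [convS, SchwartzMap.bilinLeftCLM_apply, SchwartzMap.fderivCLM_apply,
    ContinuousLinearMap.id_apply, coe_datum1S]

/-- `x ↦ Du⁰(x)[(1,1,1)]` as a Schwartz map. [cite: Godoi2016, (13.4) p.2 col.2] -/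
def dirS : 𝓢(R3, R3) := LineDeriv.lineDerivOp diag datum1S

/-- Values of `dirS`. [cite: Godoi2016, (13.4) p.2 col.2] -/
theorem dirS_apply (x : R3) : dirS x = fderiv ℝ datum1 x diag := by
  rw [dirS, SchwartzMap.lineDerivOp_apply_eq_fderiv, coe_datum1S]

/-- `Δu⁰` as a Schwartz map. [cite: Godoi2016, (13.4) p.2 col.2] -/
def lapS : 𝓢(R3, R3) := Laplacian.laplacian datum1S

/-- Values of `lapS`. [cite: Godoi2016, (13.4) p.2 col.2] -/
theorem lapS_apply (x : R3) : lapS x = Δ datum1 x := by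
  rw [lapS, ← coe_datum1S]
  exact SchwartzMap.laplacian_apply datum1S x

/-- Space factor of the `e^{−t}` part of (13.4): `−u⁰ − νΔu⁰`. [cite: Godoi2016, (13.4) p.2 col.2] -/
def forceSpace1 (ν : ℝ) : 𝓢(R3, R3) := -datum1S - ν • lapS

/-- Space factor of the `e^{−2t}` part of (13.4): `Du⁰[u⁰] + Du⁰[(1,1,1)]`. [cite: Godoi2016, (13.4) p.2 col.2] -/
def forceSpace2 : 𝓢(R3, R3) := convS + dirS

/-- Space factor of the `e^{−3t}` part of (13.4): `−Du⁰[(1,1,1)]`. [cite: Godoi2016, (13.4) p.2 col.2] -/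
def forceSpace3 : 𝓢(R3, R3) := -dirS

/-- **The force (13.4) at the datum (13.1) is a sum of three tensors** `e^{−mt} ⊗ Schwartz`, `m = 1, 2, 3`
(expand `v(t) = e^{−t}(1 − e^{−t})(1,1,1)` in (13.4)). [cite: Godoi2016, (13.2)–(13.4) p.2 col.2] -/
theorem uncurry_force1_datum1 (ν : ℝ) :
    Function.uncurry (force1 ν datum1) = fun p : ℝ × R3 =>
      Real.exp (-1 * p.1) • forceSpace1 ν p.2 + Real.exp (-2 * p.1) • forceSpace2 p.2 +
        Real.exp (-3 * p.1) • forceSpace3 p.2 := by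
  funext p
  obtain ⟨t, x⟩ := p
  simp only [Function.uncurry_apply_pair, force1, forceSpace1, forceSpace2, forceSpace3,
    sub_apply, neg_apply, smul_apply, add_apply,
    convS_apply, dirS_apply, lapS_apply, coe_datum1S, drift, w, map_smul]
  have e2 : Real.exp (-2 * t) = Real.exp (-t) * Real.exp (-t) := by
    rw [← Real.exp_add]; ring_nf
  have e3 : Real.exp (-3 * t) = Real.exp (-t) * Real.exp (-t) * Real.exp (-t) := by
    rw [← Real.exp_add, ← Real.exp_add]; ring_nf
  rw [show (-1 : ℝ) * t = -t by ring, e2, e3]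
  module

/-- The time factors `s ↦ e^{−ms}` are smooth. [folklore] -/
private theorem contDiff_expFactor (m : ℝ) : ContDiff ℝ ∞ (fun s : ℝ => Real.exp (-m * s)) :=
  Real.contDiff_exp.comp (contDiff_const.mul contDiff_id)

/-- A tensor `e^{−mt} ⊗ b` is jointly smooth. [folklore] -/
private theorem contDiff_tensor (m : ℝ) (b : 𝓢(R3, R3)) :
    ContDiff ℝ ∞ (fun p : ℝ × R3 => Real.exp (-m * p.1) • b p.2) :=
  ((contDiff_expFactor m).comp contDiff_fst).smul ((b.smooth ⊤).comp contDiff_snd)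

/-- Decay of the time factors on `t ≥ 0`, `m > 0`. [folklore] -/
private theorem expFactor_decay {m : ℝ} (hm : 0 < m) (j K : ℕ) : ∃ C : ℝ, ∀ t : ℝ, 0 ≤ t →
    (1 + t) ^ K * ‖iteratedFDeriv ℝ j (fun s : ℝ => Real.exp (-m * s)) t‖ ≤ C :=
  ⟨m ^ j * (1 + K / m) ^ K, fun _ ht => pow_mul_norm_iteratedFDeriv_exp_neg_mul_le hm j K ht⟩

/-- **The force (13.4) at the datum (13.1) is smooth on `ℝ × ℝ³`.** [cite: Godoi2016, (13.4) p.2 col.2, «f ∈ S(ℝ³ × [0,∞))»] -/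
theorem contDiff_uncurry_force1 (ν : ℝ) : ContDiff ℝ ∞ (Function.uncurry (force1 ν datum1)) := by
  rw [uncurry_force1_datum1]
  exact ((contDiff_tensor 1 _).add (contDiff_tensor 2 _)).add (contDiff_tensor 3 _)

/-- **The force (13.4) at the datum (13.1) has Fefferman's space-time decay (5).**
[cite: Godoi2016, (13.4) p.2 col.2, «f(x,t) ∈ S(ℝ³ × [0,∞)), obeying … (5)»] -/
theorem hasRapidSpaceTimeDecay_force1 (ν : ℝ) : HasRapidSpaceTimeDecay (force1 ν datum1) := by
  refine hasRapidSpaceTimeDecay_of_iteratedFDeriv (contDiff_uncurry_force1 ν) fun n K => ?_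
  obtain ⟨C₁, h₁⟩ := spaceTimeDecay_smul (contDiff_expFactor 1) (expFactor_decay one_pos)
    (forceSpace1 ν) n K
  obtain ⟨C₂, h₂⟩ := spaceTimeDecay_smul (contDiff_expFactor 2) (expFactor_decay two_pos)
    forceSpace2 n K
  obtain ⟨C₃, h₃⟩ := spaceTimeDecay_smul (contDiff_expFactor 3) (expFactor_decay three_pos)
    forceSpace3 n K
  refine ⟨C₁ + C₂ + C₃, fun t ht x => ?_⟩
  have hA : ContDiff ℝ n (fun p : ℝ × R3 => Real.exp (-1 * p.1) • forceSpace1 ν p.2) :=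
    (contDiff_tensor 1 _).of_le (by exact_mod_cast le_top)
  have hB : ContDiff ℝ n (fun p : ℝ × R3 => Real.exp (-2 * p.1) • forceSpace2 p.2) :=
    (contDiff_tensor 2 _).of_le (by exact_mod_cast le_top)
  have hC : ContDiff ℝ n (fun p : ℝ × R3 => Real.exp (-3 * p.1) • forceSpace3 p.2) :=
    (contDiff_tensor 3 _).of_le (by exact_mod_cast le_top)
  rw [uncurry_force1_datum1, fun_iteratedFDeriv_add_apply (hA.add hB).contDiffAt hC.contDiffAt,
    fun_iteratedFDeriv_add_apply hA.contDiffAt hB.contDiffAt]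
  have hw : 0 ≤ (1 + ‖x‖ + t) ^ K := by positivity
  calc (1 + ‖x‖ + t) ^ K *
        ‖iteratedFDeriv ℝ n (fun p : ℝ × R3 => Real.exp (-1 * p.1) • forceSpace1 ν p.2) (t, x) +
          iteratedFDeriv ℝ n (fun p : ℝ × R3 => Real.exp (-2 * p.1) • forceSpace2 p.2) (t, x) +
          iteratedFDeriv ℝ n (fun p : ℝ × R3 => Real.exp (-3 * p.1) • forceSpace3 p.2) (t, x)‖
      ≤ (1 + ‖x‖ + t) ^ K *
        (‖iteratedFDeriv ℝ n (fun p : ℝ × R3 => Real.exp (-1 * p.1) • forceSpace1 ν p.2) (t, x)‖ +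
          ‖iteratedFDeriv ℝ n (fun p : ℝ × R3 => Real.exp (-2 * p.1) • forceSpace2 p.2) (t, x)‖ +
          ‖iteratedFDeriv ℝ n (fun p : ℝ × R3 => Real.exp (-3 * p.1) • forceSpace3 p.2) (t, x)‖) :=
        mul_le_mul_of_nonneg_left (norm_add₃_le) hw
    _ ≤ C₁ + C₂ + C₃ := by
        have := h₁ t ht x
        have := h₂ t ht x
        have := h₃ t ht x
        linarith

/-! ### Velocity and pressure of Example 1 at the datum (13.1): smoothness, infinite energy -/

/-- `(u, p)` of (13.3): the velocity is smooth on `ℝ × ℝ³`. [cite: Godoi2016, (13.3) p.2 col.2] -/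
theorem isSmoothOnHalfSpace_velocity1_datum1 : IsSmoothOnHalfSpace (velocity1 datum1) := by
  refine isSmoothOnHalfSpace_of_contDiff ?_
  have h : Function.uncurry (velocity1 datum1) =
      fun p : ℝ × R3 => Real.exp (-1 * p.1) • datum1S p.2 + drift p.1 := by
    funext p
    obtain ⟨t, x⟩ := p
    show Real.exp (-t) • datum1 x + drift t = Real.exp (-1 * t) • datum1S x + drift t
    rw [coe_datum1S, neg_one_mul]
  rw [h]
  exact (contDiff_tensor 1 datum1S).add (contDiff_drift.comp contDiff_fst)

/-- The pressure (15) is smooth on the half-space for every smooth `θ`. [cite: Godoi2016, (15) p.2 col.2] -/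
theorem isSmoothOnHalfSpace_pressure1 {θ : ℝ → ℝ} (hθ : ContDiff ℝ ∞ θ) :
    IsSmoothOnHalfSpace (pressure1 θ) := by
  have h : Function.uncurry (pressure1 θ) =
      fun p : ℝ × R3 => Function.uncurry (driftPressure drift) p + θ p.1 := by
    funext p
    obtain ⟨t, x⟩ := p
    simp [pressure1_eq]
  unfold IsSmoothOnHalfSpace
  rw [h]
  exact (isSmoothOnHalfSpace_driftPressure contDiff_drift).add ((hθ.comp contDiff_fst).contDiffOn)

/-- `(a + b)² ≤ 4(a² + b²)` in `ℝ≥0∞` (crude). [folklore] -/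
private theorem ennreal_add_sq_le (a b : ℝ≥0∞) : (a + b) ^ 2 ≤ 4 * (a ^ 2 + b ^ 2) := by
  have h1 : a + b ≤ 2 * max a b := by
    rw [two_mul]; exact add_le_add (le_max_left _ _) (le_max_right _ _)
  have h2 : (max a b) ^ 2 ≤ a ^ 2 + b ^ 2 := by
    rcases le_total a b with h | h
    · rw [max_eq_right h]; exact le_add_self
    · rw [max_eq_left h]; exact le_self_add
  calc (a + b) ^ 2 ≤ (2 * max a b) ^ 2 := pow_le_pow_left₀ bot_le h1 2
    _ = 4 * (max a b) ^ 2 := by rw [mul_pow]; norm_num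
    _ ≤ 4 * (a ^ 2 + b ^ 2) := by gcongr

/-- **Infinite energy for `t > 0`**: `u(t) = e^{−t}u⁰ + v(t)` with `u⁰ ∈ L²` and the constant
`v(t) ≠ 0`, so `∫|u(t)|² = ∞` ((16): «∫|v|² = ∞»). [cite: Godoi2016, (16) p.2 col.2] -/
theorem lintegral_velocity1_datum1 {t : ℝ} (ht : 0 < t) : ∫⁻ x, ‖velocity1 datum1 t x‖ₑ ^ 2 = ⊤ := by
  by_contra hne
  have hv : ∫⁻ x, ‖velocity1 datum1 t x‖ₑ ^ 2 < ⊤ := lt_top_iff_ne_top.2 hne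
  -- the `L²` part `e^{-t} u⁰`
  have h0 : ∫⁻ x, ‖datum1 x‖ₑ ^ 2 < ⊤ := by
    have h := hasRapidSpatialDecay_datum1.lintegral_enorm_iteratedFDeriv_sq_lt_top (μ := (volume : Measure R3)) 0
    have heq : (fun x => ‖iteratedFDeriv ℝ 0 datum1 x‖ₑ ^ 2) = fun x => ‖datum1 x‖ₑ ^ 2 := by
      funext x
      rw [← ofReal_norm, norm_iteratedFDeriv_zero, ofReal_norm]
    rwa [heq] at h
  have ha : ∫⁻ x, ‖Real.exp (-t) • datum1 x‖ₑ ^ 2 < ⊤ := by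
    have heq : (fun x => ‖Real.exp (-t) • datum1 x‖ₑ ^ 2) =
        fun x => ‖Real.exp (-t)‖ₑ ^ 2 * ‖datum1 x‖ₑ ^ 2 := by
      funext x; rw [enorm_smul, mul_pow]
    rw [heq, lintegral_const_mul' _ _ (by simp)]
    exact ENNReal.mul_lt_top (by simp) h0
  -- the constant part
  have htop : ∫⁻ _ : R3, ‖drift t‖ₑ ^ 2 = ⊤ := lintegral_enorm_sq_driftVelocity (b := drift) (drift_ne_zero ht)
  have hpt : ∀ x : R3, ‖drift t‖ₑ ^ 2 ≤
      4 * (‖velocity1 datum1 t x‖ₑ ^ 2 + ‖Real.exp (-t) • datum1 x‖ₑ ^ 2) := by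
    intro x
    have hd : drift t = velocity1 datum1 t x - Real.exp (-t) • datum1 x := by
      simp [velocity1]
    calc ‖drift t‖ₑ ^ 2 ≤ (‖velocity1 datum1 t x‖ₑ + ‖Real.exp (-t) • datum1 x‖ₑ) ^ 2 := by
          rw [hd]; exact pow_le_pow_left₀ bot_le enorm_sub_le 2
      _ ≤ _ := ennreal_add_sq_le _ _
  have hmeas : Measurable fun x : R3 => ‖velocity1 datum1 t x‖ₑ ^ 2 := by
    have hc : Continuous (fun x : R3 => Real.exp (-t) • datum1 x + drift t) :=
      ((continuous_const (y := Real.exp (-t))).smul contDiff_datum1.continuous).add continuous_const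
    exact hc.measurable.enorm.pow_const 2
  have hle : ∫⁻ _ : R3, ‖drift t‖ₑ ^ 2 ≤
      4 * ((∫⁻ x, ‖velocity1 datum1 t x‖ₑ ^ 2) + ∫⁻ x, ‖Real.exp (-t) • datum1 x‖ₑ ^ 2) := by
    calc ∫⁻ _ : R3, ‖drift t‖ₑ ^ 2
        ≤ ∫⁻ x, 4 * (‖velocity1 datum1 t x‖ₑ ^ 2 + ‖Real.exp (-t) • datum1 x‖ₑ ^ 2) :=
          lintegral_mono hpt
      _ = 4 * ((∫⁻ x, ‖velocity1 datum1 t x‖ₑ ^ 2) + ∫⁻ x, ‖Real.exp (-t) • datum1 x‖ₑ ^ 2) := by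
          rw [lintegral_const_mul' _ _ (by norm_num), lintegral_add_left hmeas]
  have hfin : 4 * ((∫⁻ x, ‖velocity1 datum1 t x‖ₑ ^ 2) + ∫⁻ x, ‖Real.exp (-t) • datum1 x‖ₑ ^ 2) < ⊤ :=
    ENNReal.mul_lt_top (by simp) (ENNReal.add_lt_top.2 ⟨hv, ha⟩)
  exact absurd htop (ne_of_lt (hle.trans_lt hfin))

/-- **Step 1 — Example 1 AT THE PRINTED GAUSSIAN DATUM (13.1), PROVED**: for every `ν > 0` and every
smooth `θ`, the datum (13.1) is a Clay datum (4) (smooth, divergence free, Schwartz decay), the force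
(13.4) is smooth with the space-time decay (5), `(u, p)` of (13.3)/(15) is smooth on `ℝ³ × [0,∞)` and
solves (1), (2), (3) («guaranteed by construction and direct substitution», p.8 col.2), and
`∫|u(x,t)|²dx = ∞` for every `t > 0` ((16)). Net D-0026 debt −1 for the claim file; verdict #111
(false lemma @ `UniqLocal`) is untouched — the example is correct, the uniqueness inference is not.
[cite: Godoi2016, (13.1)–(16) p.2 col.2; Conclusion p.8 col.1–2] -/
theorem example1_holds : Example1 := by
  intro ν _ θ hθ
  exact ⟨contDiff_datum1, isDivFree_datum1, hasRapidSpatialDecay_datum1,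
    isSmoothOnHalfSpace_of_contDiff (contDiff_uncurry_force1 ν), hasRapidSpaceTimeDecay_force1 ν,
    isSmoothOnHalfSpace_velocity1_datum1, isSmoothOnHalfSpace_pressure1 hθ,
    isNavierStokesSolution_velocity1 ν (contDiff_datum1.of_le (by norm_cast)) isDivFree_datum1 θ,
    fun t ht => lintegral_velocity1_datum1 ht⟩

end Example1Gaussian

end Literature.Claims.NS.Godoi2016

end

-- WHAT THIS IS NOT: not a claim about NS regularity or blow-up; not a claim about any author beyond the
-- typed locator.
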